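import Summits.BirchSwinnertonDyer.BirchSwinnertonDyer.Theses.RamifiedHeegnerPair
import Summits.BirchSwinnertonDyer.BirchSwinnertonDyer.Theorems.RamifiedHeegnerPairGss2LowerAtThreeRankOneIrreducibleRoad
import Summits.BirchSwinnertonDyer.BirchSwinnertonDyer.Theorems.RamifiedHeegnerPairGss2LowerAtThreeRankOneNonTowerOfNonSurjThree
import Summits.BirchSwinnertonDyer.BirchSwinnertonDyer.Theorems.RamifiedHeegnerPairLeafRankOneUpperAtThreeLeafTwistStable
import HarnessLib

/-!
# Route `RamifiedHeegnerPair`, crux L₁ `Gss2LowerAtThreeRankOne` (stmt-BirchSwinnertonDyer-26021) — the IRREDUCIBLE-IMAGE road,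
# PART 2 of 2: BY NAME — the declared residual NT (27201) ⟸ seven named facts ∧ A₃ₙₙ ∧ U₀ (26024); L₁ (26021) ⟸ the same ∧ A′ ∧ U₀

HONEST FRAMING. Theorems only (no definition, no named fact, no `sorry`); helper file (`--supports stmt-BirchSwinnertonDyer-27201`);
nothing is booked, no item is closed, BSD is not proved for any curve; every displayed input is a hypothesis. Lead prover
bsd-line-rhp-p1 g5, 2026-08-28. Sequel of `…IrreducibleRoad.lean` (Part 1: §5–§8, the route-independent doors — the twist's upper
half in the road's currency, the adjusted STEP L from ONE certificate under IRREDUCIBILITY via the gate-accepted Literature fact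
`MatarNekovar2019.thm07_pow_dvd_card_sha_primary_of_certificate_of_irreducible`, and the pointwise door on ANY Gss2 rank-one row from
seven named facts ∧ one certificate ∧ `MissingUpperBoundAt Wd 3`), of `…NonTowerOfNonSurjThree.lean` (NT ⟺ the `3Nn` rows) and of
`…LeafRankOneUpperAtThreeLeafTwistStable.lean` (rhp-p2 g2: the odd-discriminant Heegner twist `Wd` of a leaf curve is on the leaf).

* §9  CLASS LEVEL: `gss2LowerAtThreeRankOne_allRows_of_exists_certificate_of_leafRankZeroUpper` — L₁ on EVERY row of the Gss2
  rank-one leaf ⟸ seven named facts ∧ A′ := [per row SOME odd split Heegner frame with SOME McCallum certificate of adjusted BSD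
  depth] ∧ U₀ = item 26024 `LeafRankZeroUpperAtThree` BY NAME (consumed at the rank-`0` twists `Wd`, which are on the leaf);
  `gss2LowerAtThreeRankOne_nonSurjRows_of_exists_certificate_of_leafRankZeroUpper` — the same on the `3Nn` rows from A₃ₙₙ.
* §10 BY NAME: **`gss2LowerAtThreeRankOneNonTower_of_structIrr_of_certificates3Nn_of_leafRankZeroUpper`** (NT 27201 ⟸ seven facts ∧
  A₃ₙₙ ∧ U₀ 26024) and **`gss2LowerAtThreeRankOne_of_pub_of_structIrr_of_certificatesAll_of_leafRankZeroUpper`** (L₁ 26021 ⟸ seven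
  facts ∧ A′ ∧ U₀ 26024 — no residual, no image split).

RESHAPE DATUM for the planner (lead's reading; texts in the skeleton v4 of line `kolyvagin_split`): the declared residual NT 27201
(«no structure theorem in print on the non-tower rows») is NOT an atom — it may be RETIRED in favour of {A₃ₙₙ = the certificate
statement of A 27200 asked on the `3Nn` rows at an odd-discriminant frame (same currency, same per-pair instrument: T1⁻ at an
additive 3), U₀ 26024 (already a member of `closes`), and ONE cited fact already in the tree (Matar–Nekovář 2019 Thm. 0.7 / §0.11,
flags `MN19-0.11-structure-composite` / `Kolyvagin1991-ThmCD-primary-unread` travelling with it)}. BSD is not proved by any of this.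

References: [cite: MatarNekovar2019, Thm. 0.7 (p. 456) and §0.11 (p. 457)] [cite: Cha2005, Rmk. 25] [cite: McCallumLMS1991, §5
Lemma 5.1 (p. 303), Cor. 5.6 (p. 310)] [cite: JetchevSkinnerWan2017, §7.4.1 (pp. 29–31)] [cite: Miller2011LMS, Def. 1.1].
-/

-- D-0017: single-problem summit, so `Summit.BirchSwinnertonDyer.BirchSwinnertonDyer.…` repeats a namespace BY DESIGN.
set_option linter.dupNamespace false
set_option autoImplicit false

noncomputable section

open scoped Classical NumberField

open WeierstrassCurve NumberField IsDedekindDomain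
  Literature.NumberTheory.EllipticCurves Literature.NumberTheory.EllipticCurves.ModularForms
  Literature.NumberTheory.EllipticCurves.Rank1Residual
  Literature.NumberTheory.EllipticCurves.Rank1Residual.Typed
  Summit.BirchSwinnertonDyer.Rank1Residual
  Summit.BirchSwinnertonDyer.Rank1Residual.Additive
  Summit.BirchSwinnertonDyer.Rank1Residual.X11b
  Summit.BirchSwinnertonDyer.BirchSwinnertonDyer.Theorems

namespace Summit.BirchSwinnertonDyer.BirchSwinnertonDyer.Theorems.RamifiedPairLowerBound

/-! ## §9 CLASS LEVEL: L₁ on ALL rows / on the `3Nn` rows ⟸ seven facts ∧ [per row SOME odd frame with SOME certificate] ∧ U₀ 26024 -/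

/-- **L₁ on EVERY row of the Gss2 rank-one leaf ⟸ seven named facts ∧ A′ ∧ U₀.** NAMED published binders (tree facts, taken as
hypotheses, never progress): Gross–Zagier `hGZ`, Kolyvagin `hKo`, GZK `hGZK`, modularity `hmod`, Shimura reciprocity at
conductor `1` `hrec`, Darmon 2004 Thm. 3.6 `h36`, and Kolyvagin's structure theorem under irreducibility `hMN` (Matar–Nekovář
2019 Thm. 0.7 / §0.11). LOAD-BEARING INPUT `hC` (A′, ∃-form, McCallum currency, NO image binder): for every non-CM globally minimal
`E/ℚ` additive (G) ∧ ss at `3` with `r_an(E) = 1`, SOME level `N = N_E`, SOME imaginary quadratic `K′` of ODD discriminant with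
the Heegner hypothesis for `N_E` and `L(E^{(d_{K′})},1) ≠ 0`, SOME datum `(Dt, H, ι)` with its Heegner point `P ∈ E(K′)`, SOME
globally minimal model `Wd` of the twist, SOME depth `M` with `2M ≤ ord₃∏c(E) + ord₃∏c(Wd) + 2·ord₃ c(Dt)` and SOME certificate
`Koly.CertificateAt Dt H.β ι 3 M`. TYPED INPUT `hU0`: the route's member U₀ = item 26024 `LeafRankZeroUpperAtThree` BY NAME (used at
the twists `Wd`, which lie on the leaf by `RamifiedPairUpperBound.leaf_twist_of_heegner` and have `r_an = 0`). CONCLUSION: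
`Typed.MissingLowerBoundAt E 3` on the whole rank-one leaf. [cite: MatarNekovar2019, Thm. 0.7 (p. 456) and §0.11 (p. 457)]
[cite: McCallumLMS1991, §5 Cor. 5.6 (p. 310)] [cite: JetchevSkinnerWan2017, §7.4.1 (pp. 29–31)] [cite: Miller2011LMS, Def. 1.1] -/
theorem gss2LowerAtThreeRankOne_allRows_of_exists_certificate_of_leafRankZeroUpper
    (hGZ : ∀ (N : ℕ) [NeZero N] (W : WeierstrassCurve ℚ) (K : Type) [Field K] [NumberField K],
      gross_zagier N W K)
    (hKo : ∀ (N : ℕ) [NeZero N] (W : WeierstrassCurve ℚ) (K : Type) [Field K] [NumberField K],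
      kolyvagin N W K)
    (hGZK : rank_eq_analyticRank_of_analyticRank_le_one) (hmod : hasEntireLFunction_rat)
    (hrec : ∀ (N : ℕ) [NeZero N] (W : WeierstrassCurve ℚ) (K : Type) [Field K] [NumberField K],
      heegnerPointOfConductor_one_galoisConj N W K)
    (h36 : ∀ (N : ℕ) [NeZero N] (W : WeierstrassCurve ℚ) (K : Type) [Field K] [NumberField K],
      phi_heegnerTau_mem_range_map_singularModuliField N W K)
    (hMN : MatarNekovar2019.thm07_pow_dvd_card_sha_primary_of_certificate_of_irreducible)
    (hC : ∀ (W : WeierstrassCurve ℚ) [W.IsElliptic] [W.IsGloballyMinimal],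
      ¬ W.HasCM → Addv W 3 → SubGss W 3 → W.analyticRank = 1 →
      ∃ (N : ℕ) (_ : NeZero N) (K : Type) (_ : Field K) (_ : NumberField K)
        (Dt : ModularParametrizationData W N) (H : HeegnerDatum N (NumberField.discr K)) (ι : K →+* ℂ)
        (P : (W.baseChange K).toAffine.Point)
        (Wd : WeierstrassCurve ℚ) (_ : Wd.IsElliptic) (_ : Wd.IsGloballyMinimal) (Cd : VariableChange ℚ) (M : ℕ),
        W.conductorNorm ℤ = N ∧ IsImaginaryQuadratic K ∧ Odd (NumberField.discr K) ∧ SatisfiesHeegnerHypothesis N K ∧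
        (W.quadraticTwist (NumberField.discr K : ℚ)).entireLFunction 1 ≠ 0 ∧
        WeierstrassCurve.Affine.Point.map ι.toRatAlgHom P = heegnerPointComplex Dt H ∧
        Cd • W.quadraticTwist (NumberField.discr K : ℚ) = Wd ∧
        (2 * M : ℤ) ≤ padicValNat 3 W.tamagawaProduct + padicValNat 3 Wd.tamagawaProduct +
          2 * padicValRat 3 (Dt.c : ℚ) ∧
        Three.Koly.CertificateAt Dt H.β ι 3 M)
    (hU0 : Summit.BirchSwinnertonDyer.BirchSwinnertonDyer.Theses.RamifiedHeegnerPair.LeafRankZeroUpperAtThree) :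
    ∀ (W : WeierstrassCurve ℚ) [W.IsElliptic] [W.IsGloballyMinimal],
      ¬ W.HasCM → Addv W 3 → SubGss W 3 → W.analyticRank = 1 → MissingLowerBoundAt W 3 := by
  intro W _ _ hCM hadd hsub hr
  obtain ⟨N, hN0, K, _, _, Dt, H, ι, P, Wd, _, _, Cd, M, hN, hK, hodd, hHN, hLt, hP, hWd, hM, hcert⟩ :=
    hC W hCM hadd hsub hr
  haveI : NeZero N := hN0
  subst hN
  -- the twist is on the leaf, of analytic rank `0`: its upper half is an instance of U₀ (item 26024)
  obtain ⟨hCMd, haddd, hsubd, -⟩ :=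
    RamifiedPairUpperBound.leaf_twist_of_heegner W hCM hadd hsub K hK hHN hodd Wd Cd hWd
  have hD0 : (NumberField.discr K : ℚ) ≠ 0 := by exact_mod_cast NumberField.discr_ne_zero K
  haveI hEt : (W.quadraticTwist (NumberField.discr K : ℚ)).IsElliptic := W.isElliptic_quadraticTwist hD0
  have hLt' : (W.quadraticTwist (NumberField.discr K : ℚ)).entireLFunction = Wd.entireLFunction := by
    rw [← hWd, entireLFunction_smul]
  have hLd1 : Wd.entireLFunction 1 ≠ 0 := by rw [← hLt']; exact hLt
  have hrd : Wd.analyticRank = 0 := (Wd.analyticRank_eq_zero_iff_holds (hmod Wd)).2 hLd1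
  have hUd : MissingUpperBoundAt Wd 3 := hU0 Wd hCMd haddd hsubd hrd
  exact missingLowerBoundAt_three_rankOne_gss_of_structIrrCertificate_of_upperTwist W K Dt H ι P (hGZ _ W K) (hKo _ W K)
    hGZK hmod (hrec _ W K) (h36 _ W K) hMN hCM hadd hsub hr hK hHN hP hLt Wd Cd hWd hUd hcert hM

/-- **L₁ on the `3Nn` rows (ρ̄₃ NOT onto) ⟸ seven named facts ∧ A₃ₙₙ ∧ U₀** — the same with the certificate asked only on the
rows with `ρ̄_{E,3}` not onto (the declared residual's rows, `…NonTowerOfNonSurjThree` §2/§4).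
[cite: MatarNekovar2019, Thm. 0.7 (p. 456) and §0.11 (p. 457)] [cite: McCallumLMS1991, §5 Cor. 5.6 (p. 310)] -/
theorem gss2LowerAtThreeRankOne_nonSurjRows_of_exists_certificate_of_leafRankZeroUpper
    (hGZ : ∀ (N : ℕ) [NeZero N] (W : WeierstrassCurve ℚ) (K : Type) [Field K] [NumberField K],
      gross_zagier N W K)
    (hKo : ∀ (N : ℕ) [NeZero N] (W : WeierstrassCurve ℚ) (K : Type) [Field K] [NumberField K],
      kolyvagin N W K)
    (hGZK : rank_eq_analyticRank_of_analyticRank_le_one) (hmod : hasEntireLFunction_rat)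
    (hrec : ∀ (N : ℕ) [NeZero N] (W : WeierstrassCurve ℚ) (K : Type) [Field K] [NumberField K],
      heegnerPointOfConductor_one_galoisConj N W K)
    (h36 : ∀ (N : ℕ) [NeZero N] (W : WeierstrassCurve ℚ) (K : Type) [Field K] [NumberField K],
      phi_heegnerTau_mem_range_map_singularModuliField N W K)
    (hMN : MatarNekovar2019.thm07_pow_dvd_card_sha_primary_of_certificate_of_irreducible)
    (hC : ∀ (W : WeierstrassCurve ℚ) [W.IsElliptic] [W.IsGloballyMinimal],
      ¬ W.HasCM → Addv W 3 → SubGss W 3 → W.analyticRank = 1 → ¬ W.HasSurjectiveModNGaloisRep 3 →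
      ∃ (N : ℕ) (_ : NeZero N) (K : Type) (_ : Field K) (_ : NumberField K)
        (Dt : ModularParametrizationData W N) (H : HeegnerDatum N (NumberField.discr K)) (ι : K →+* ℂ)
        (P : (W.baseChange K).toAffine.Point)
        (Wd : WeierstrassCurve ℚ) (_ : Wd.IsElliptic) (_ : Wd.IsGloballyMinimal) (Cd : VariableChange ℚ) (M : ℕ),
        W.conductorNorm ℤ = N ∧ IsImaginaryQuadratic K ∧ Odd (NumberField.discr K) ∧ SatisfiesHeegnerHypothesis N K ∧
        (W.quadraticTwist (NumberField.discr K : ℚ)).entireLFunction 1 ≠ 0 ∧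
        WeierstrassCurve.Affine.Point.map ι.toRatAlgHom P = heegnerPointComplex Dt H ∧
        Cd • W.quadraticTwist (NumberField.discr K : ℚ) = Wd ∧
        (2 * M : ℤ) ≤ padicValNat 3 W.tamagawaProduct + padicValNat 3 Wd.tamagawaProduct +
          2 * padicValRat 3 (Dt.c : ℚ) ∧
        Three.Koly.CertificateAt Dt H.β ι 3 M)
    (hU0 : Summit.BirchSwinnertonDyer.BirchSwinnertonDyer.Theses.RamifiedHeegnerPair.LeafRankZeroUpperAtThree) :
    ∀ (W : WeierstrassCurve ℚ) [W.IsElliptic] [W.IsGloballyMinimal],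
      ¬ W.HasCM → Addv W 3 → SubGss W 3 → W.analyticRank = 1 → ¬ W.HasSurjectiveModNGaloisRep 3 →
      MissingLowerBoundAt W 3 := by
  intro W _ _ hCM hadd hsub hr hns
  obtain ⟨N, hN0, K, _, _, Dt, H, ι, P, Wd, _, _, Cd, M, hN, hK, hodd, hHN, hLt, hP, hWd, hM, hcert⟩ :=
    hC W hCM hadd hsub hr hns
  haveI : NeZero N := hN0
  subst hN
  obtain ⟨hCMd, haddd, hsubd, -⟩ :=
    RamifiedPairUpperBound.leaf_twist_of_heegner W hCM hadd hsub K hK hHN hodd Wd Cd hWd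
  have hD0 : (NumberField.discr K : ℚ) ≠ 0 := by exact_mod_cast NumberField.discr_ne_zero K
  haveI hEt : (W.quadraticTwist (NumberField.discr K : ℚ)).IsElliptic := W.isElliptic_quadraticTwist hD0
  have hLt' : (W.quadraticTwist (NumberField.discr K : ℚ)).entireLFunction = Wd.entireLFunction := by
    rw [← hWd, entireLFunction_smul]
  have hLd1 : Wd.entireLFunction 1 ≠ 0 := by rw [← hLt']; exact hLt
  have hrd : Wd.analyticRank = 0 := (Wd.analyticRank_eq_zero_iff_holds (hmod Wd)).2 hLd1
  have hUd : MissingUpperBoundAt Wd 3 := hU0 Wd hCMd haddd hsubd hrd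
  exact missingLowerBoundAt_three_rankOne_gss_of_structIrrCertificate_of_upperTwist W K Dt H ι P (hGZ _ W K) (hKo _ W K)
    hGZK hmod (hrec _ W K) (h36 _ W K) hMN hCM hadd hsub hr hK hHN hP hLt Wd Cd hWd hUd hcert hM

/-! ## §10 BY NAME: the residual NT (27201) and the crux L₁ (26021) -/

/-- **NT 27201 `Gss2LowerAtThreeRankOneNonTower` ⟸ seven named facts ∧ A₃ₙₙ ∧ U₀ 26024** — the declared residual of the rev-9
split is NOT an atom: granted Gross–Zagier, Kolyvagin, GZK, modularity, Shimura reciprocity, Darmon 3.6 and Kolyvagin's structure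
theorem under IRREDUCIBILITY (`MatarNekovar2019.thm07_…_of_irreducible`, gate-accepted Literature fact), it follows from ONE
derived-point certificate of adjusted BSD depth per `3Nn` row (A₃ₙₙ: the text of A 27200 with the tower binder replaced by
`¬ ρ̄_{E,3}` onto plus `¬CM` and an odd-discriminant frame — same currency, same per-pair instrument) and the route's OWN member U₀
(item 26024, BY NAME, consumed at the rank-`0` twists). RESHAPE DATUM: NT may be retired in favour of {A₃ₙₙ, 26024}. CONDITIONAL on
all displayed inputs; BSD is not proved by this. [cite: MatarNekovar2019, Thm. 0.7 (p. 456) and §0.11 (p. 457)]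
[cite: McCallumLMS1991, §5 Cor. 5.6 (p. 310)] [cite: Cha2005, Rmk. 25] [cite: Miller2011LMS, Def. 1.1] -/
theorem gss2LowerAtThreeRankOneNonTower_of_structIrr_of_certificates3Nn_of_leafRankZeroUpper
    (hGZ : ∀ (N : ℕ) [NeZero N] (W : WeierstrassCurve ℚ) (K : Type) [Field K] [NumberField K],
      gross_zagier N W K)
    (hKo : ∀ (N : ℕ) [NeZero N] (W : WeierstrassCurve ℚ) (K : Type) [Field K] [NumberField K],
      kolyvagin N W K)
    (hGZK : rank_eq_analyticRank_of_analyticRank_le_one) (hmod : hasEntireLFunction_rat)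
    (hrec : ∀ (N : ℕ) [NeZero N] (W : WeierstrassCurve ℚ) (K : Type) [Field K] [NumberField K],
      heegnerPointOfConductor_one_galoisConj N W K)
    (h36 : ∀ (N : ℕ) [NeZero N] (W : WeierstrassCurve ℚ) (K : Type) [Field K] [NumberField K],
      phi_heegnerTau_mem_range_map_singularModuliField N W K)
    (hMN : MatarNekovar2019.thm07_pow_dvd_card_sha_primary_of_certificate_of_irreducible)
    (hC : ∀ (W : WeierstrassCurve ℚ) [W.IsElliptic] [W.IsGloballyMinimal],
      ¬ W.HasCM → Addv W 3 → SubGss W 3 → W.analyticRank = 1 → ¬ W.HasSurjectiveModNGaloisRep 3 →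
      ∃ (N : ℕ) (_ : NeZero N) (K : Type) (_ : Field K) (_ : NumberField K)
        (Dt : ModularParametrizationData W N) (H : HeegnerDatum N (NumberField.discr K)) (ι : K →+* ℂ)
        (P : (W.baseChange K).toAffine.Point)
        (Wd : WeierstrassCurve ℚ) (_ : Wd.IsElliptic) (_ : Wd.IsGloballyMinimal) (Cd : VariableChange ℚ) (M : ℕ),
        W.conductorNorm ℤ = N ∧ IsImaginaryQuadratic K ∧ Odd (NumberField.discr K) ∧ SatisfiesHeegnerHypothesis N K ∧
        (W.quadraticTwist (NumberField.discr K : ℚ)).entireLFunction 1 ≠ 0 ∧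
        WeierstrassCurve.Affine.Point.map ι.toRatAlgHom P = heegnerPointComplex Dt H ∧
        Cd • W.quadraticTwist (NumberField.discr K : ℚ) = Wd ∧
        (2 * M : ℤ) ≤ padicValNat 3 W.tamagawaProduct + padicValNat 3 Wd.tamagawaProduct +
          2 * padicValRat 3 (Dt.c : ℚ) ∧
        Three.Koly.CertificateAt Dt H.β ι 3 M)
    (hU0 : Summit.BirchSwinnertonDyer.BirchSwinnertonDyer.Theses.RamifiedHeegnerPair.LeafRankZeroUpperAtThree) :
    Summit.BirchSwinnertonDyer.BirchSwinnertonDyer.Theses.RamifiedHeegnerPair.Gss2LowerAtThreeRankOneNonTower :=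
  gss2LowerAtThreeRankOneNonTower_of_nonSurjThree
    (gss2LowerAtThreeRankOne_nonSurjRows_of_exists_certificate_of_leafRankZeroUpper hGZ hKo hGZK hmod hrec h36 hMN hC hU0)

/-- **L₁ 26021 `Gss2LowerAtThreeRankOne` ⟸ seven named facts ∧ A′ (certificates on ALL rows) ∧ U₀ 26024** — the crux BY NAME with
NO residual and NO image split: on every row of the leaf the structure theorem is the irreducible-image fact and the twist's upper
half is the route's member U₀. CONDITIONAL on all displayed inputs (A′ = T1⁻ at an additive `3`, OPEN; U₀, OPEN off the Kato-sharp
rows; seven print facts); BSD is not proved by this. [cite: MatarNekovar2019, Thm. 0.7 (p. 456) and §0.11 (p. 457)]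
[cite: McCallumLMS1991, §5 Cor. 5.6 (p. 310)] [cite: JetchevSkinnerWan2017, §7.4.1 (pp. 29–31)] [cite: Miller2011LMS, Def. 1.1] -/
theorem gss2LowerAtThreeRankOne_of_pub_of_structIrr_of_certificatesAll_of_leafRankZeroUpper
    (hGZ : ∀ (N : ℕ) [NeZero N] (W : WeierstrassCurve ℚ) (K : Type) [Field K] [NumberField K],
      gross_zagier N W K)
    (hKo : ∀ (N : ℕ) [NeZero N] (W : WeierstrassCurve ℚ) (K : Type) [Field K] [NumberField K],
      kolyvagin N W K)
    (hGZK : rank_eq_analyticRank_of_analyticRank_le_one) (hmod : hasEntireLFunction_rat)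
    (hrec : ∀ (N : ℕ) [NeZero N] (W : WeierstrassCurve ℚ) (K : Type) [Field K] [NumberField K],
      heegnerPointOfConductor_one_galoisConj N W K)
    (h36 : ∀ (N : ℕ) [NeZero N] (W : WeierstrassCurve ℚ) (K : Type) [Field K] [NumberField K],
      phi_heegnerTau_mem_range_map_singularModuliField N W K)
    (hMN : MatarNekovar2019.thm07_pow_dvd_card_sha_primary_of_certificate_of_irreducible)
    (hC : ∀ (W : WeierstrassCurve ℚ) [W.IsElliptic] [W.IsGloballyMinimal],
      ¬ W.HasCM → Addv W 3 → SubGss W 3 → W.analyticRank = 1 →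
      ∃ (N : ℕ) (_ : NeZero N) (K : Type) (_ : Field K) (_ : NumberField K)
        (Dt : ModularParametrizationData W N) (H : HeegnerDatum N (NumberField.discr K)) (ι : K →+* ℂ)
        (P : (W.baseChange K).toAffine.Point)
        (Wd : WeierstrassCurve ℚ) (_ : Wd.IsElliptic) (_ : Wd.IsGloballyMinimal) (Cd : VariableChange ℚ) (M : ℕ),
        W.conductorNorm ℤ = N ∧ IsImaginaryQuadratic K ∧ Odd (NumberField.discr K) ∧ SatisfiesHeegnerHypothesis N K ∧
        (W.quadraticTwist (NumberField.discr K : ℚ)).entireLFunction 1 ≠ 0 ∧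
        WeierstrassCurve.Affine.Point.map ι.toRatAlgHom P = heegnerPointComplex Dt H ∧
        Cd • W.quadraticTwist (NumberField.discr K : ℚ) = Wd ∧
        (2 * M : ℤ) ≤ padicValNat 3 W.tamagawaProduct + padicValNat 3 Wd.tamagawaProduct +
          2 * padicValRat 3 (Dt.c : ℚ) ∧
        Three.Koly.CertificateAt Dt H.β ι 3 M)
    (hU0 : Summit.BirchSwinnertonDyer.BirchSwinnertonDyer.Theses.RamifiedHeegnerPair.LeafRankZeroUpperAtThree) :
    Summit.BirchSwinnertonDyer.BirchSwinnertonDyer.Theses.RamifiedHeegnerPair.Gss2LowerAtThreeRankOne := by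
  intro W _ _ hCM hadd hsub hr
  exact gss2LowerAtThreeRankOne_allRows_of_exists_certificate_of_leafRankZeroUpper hGZ hKo hGZK hmod hrec h36 hMN hC hU0 W
    hCM hadd hsub hr

end Summit.BirchSwinnertonDyer.BirchSwinnertonDyer.Theorems.RamifiedPairLowerBound

end
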